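import Summits.BirchSwinnertonDyer.Rank1Residual.Additive.X4SharpThreeKimRankOneConsequences
import Literature.NumberTheory.EllipticCurves.KuriharaNumberInvariants
import HarnessLib

/-!
# X4 ∧ `r_an = 1`: the RANK-ONE structure clause in `∂`-currency ("length Ш[p^∞] = ∂^{(1)} − ∂^{(∞)}")
# typed at a prime `p` (conjecture at `3`) — FILE 1 of T-a2r1b: bookkeeping, the three `@[conjecture]`
# defs, and the refinement of T-a2r1's landed shapes; FILE 2 (`Additive/X4RankOneKimTamagawaDefect.lean`)
# composes it with the `≥` half of Kim's Conjecture 1.10 (`X4.KimTamagawaDefectGeAt`, T-N10C) on the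
# TAMAGAWA rows of O7 ∩ X4@3 (cell `b2b-bsdres`, team n1011, sub-target T-a2r1b — lead GO R3-15)

HONEST FRAMING (cell `b2b-bsdres`, run/shared/lean/b2b/bsd-rank1-residual/, verbatim in every
file): the goal of the cell is to DELETE the COMBINATION-SHAPED residual classes of the
Birch–Swinnerton-Dyer formula for ALL analytic-rank `≤ 1` elliptic curves over `ℚ` — "full BSD
formula for every rank `≤ 1` curve in class `C`" assembled STRICTLY from published theorems — so
that the rank-`≤ 1` remainder becomes exactly the CONSTRUCTION-SHAPED classes, which are TYPED
(missing-input `Prop`s), NOT attempted. This is not "finishing BSD". Team n1011: prove what is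
provable now; shrink each hard class to its core with data; no claim beyond stated classes;
research routes; census output = EVIDENCE / conjecture items, never a Literature fact. X4 stays
CONSTRUCTION-SHAPED; nothing here is booked; §I O7 / N11 unchanged. Three `@[conjecture] def`s (our
theory, Summits) + theorems; NO Literature fact minted; every published input and every conjecture
is an explicit hypothesis; `#print axioms` standard.

## Why (the O7 ∩ X4@3 rank-one anatomy, `HOME/b2b-bsdres-n1011-p17/census/O7-X4AT3-RANKONE-ANATOMY.md`,
single-engine join + kit j121082, UNCERTIFIED): of the 10 692 S-b X4 ∧ `p = 3` ∧ `r_an = 1` pairs,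
the unit / level-two certificate shapes of `X4SharpThreeKimRankOne*` (p249591 / p249974) reach at
most 1 575 + 561; **7 903 (74 %) have `ord₃ ∏_ℓ c_ℓ ≥ 2` with `3 ∤ #Ш_an`** (the 3-part of `∏c` sits on
two primes on 7 589 of them, `c₃ = 3` at Kodaira IV/IV* on 3 891). On such a row NO unit Kurihara
number exists if Kim's Conjecture 1.10 holds (`∂^{(∞)} = ord_p ∏c ≥ 2`), and a level-`k` certificate
bounds `ord_p #Ш ≤ k − 1` only — useless for `k − 1 ≥ 2`. What those rows need is clause (6) WITH ITS
`∂^{(∞)}` TERM plus the `≥` half of Conjecture 1.10: then a certificate at the RIGHT level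
`k = ord_p ∏c + 1` gives `ord_p #Ш ≤ (k − 1) − ord_p ∏c = 0`.

## What this file does

* §0 `∂`-bookkeeping over cc-typer-1's invariants (`Literature/…/KuriharaNumberInvariants.lean`):
  `kuriharaDivIndex_le_of_kuriharaNumber_ne_zero` (a Kurihara number non-zero mod `p^k` at a level
  `n ∈ 𝒩_k` has divisibility index `≤ k − 1`), `isCyclicKolyvaginLevel_of_prime`,
  `kuriharaPartial_one_le_of_kuriharaNumber_ne_zero` (`∂^{(1)} ≤ k − 1` from ONE prime-level
  certificate).
* §1 `KimRankOnePartialAt W p` (`@[conjecture]`, per pair, p-generic; T-a2's binder convention: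
  `Surj W p →`, tower, `L(E,1) = 0`, `r_an = 1`, `Ш` finite, datum `D` with `p ∤ c_D`, period
  transfer): **`∂^{(1)}(δ̃) ≠ ∞ ⟹ length_{ℤ_p} Ш(E/ℚ)[p^∞] + ∂^{(∞)}(δ̃) = ∂^{(1)}(δ̃)`** in `ℕ∞` —
  Kim 2026 Thm. 1.9 (6) in analytic rank `1` (`ord(δ̃) = 1` is witnessed by `δ̃_1 = L(E,1)/Ω = 0`
  and `∂^{(1)} < ∞`) with its `∂^{(∞)}` term KEPT (the tree's rank-one facts and p249591 are its
  corollaries at `∂^{(1)} ∈ {0, ≤ 1}`). PRINTED for `p ≥ 5` (a STATEMENT of the refereed paper; the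
  tree has not typed clause (6) in `∂`-currency yet — cc-typer-1's T1 — so no `_of_five_le` here;
  when that fact lands the sanity lemma is one line); ANNOUNCED for `p ≥ 3` under large image
  (Kim 2025 Thm. 1.1 (Str), PREPRINT, flag `Kim2025-preprint`); at `p = 3` OUR CONJECTURE.
  Closures `KimThreeRankOnePartial` (every `E`) and `X4SharpThreeKimRankOnePartial` (`Addv W 3`).
* §2 anti-drift inside T-a2r1's family: `kimRankOneUnitAt_of_partial`,
  `kimRankOneLevelTwoAt_of_partial` — the `∂`-currency statement REFINES the two landed shapes.
* §3 the composition with the `≥` half of Conjecture 1.10 (p12's `X4.KimTamagawaDefectGeAt W p D.f`,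
  T-N10C, rank-agnostic — CONSUMED, not re-typed, lead R3-15 name discipline):
  `padicValNat_primaryComponent_add_le_of_partial_of_tamagawaDefectGe` (`ord_p #Ш(p) + ord_p ∏c ≤ k − 1`
  from ONE `δ̃_ℓ ≢ 0 (mod p^k)` at a cyclic `ℓ ∈ 𝒫_k`), hence `card_primaryComponent_eq_one_…`
  at the exact level `k = ord_p ∏c + 1`, the `+2` level with Cassels–Tate parity, and `BSD(E,p)` on
  the `p ∤ #Ш_an` rows; the level-side PREDICTION `kuriharaNumber_eq_zero_of_tamagawaDefectGe_of_level_le`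
  (the `≥` half of Conj. 1.10 alone forbids a non-zero `δ̃_ℓ^{(k)}` at any cyclic prime of level
  `k ≤ ord_p ∏c`, rank-free; what the rank-one clause adds is the USE of a non-zero value AT level
  `ord_p ∏c + 1` — whose EXISTENCE in rank one at an additive `p` no source announces: Kim 2025
  Thm. 1.2 (rk1+ε) needs `p² ∤ N`).
* §4 the `p = 3` census shapes on the TAM rows of O7 ∩ X4@3 (`X4RankOne.bsdp_three_of_partial_…`),
  tower certificate by `towerSurj_three_of_surj_of_jWitness_or_nine`, optimal-datum form by
  `X4.periodTransfer_of_optimal` (`hopt` + `3 ∤ c_D` explicit).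

Nothing here is a class theorem; the two conjectures are explicit hypotheses of every theorem; the
EXOTIC (no tower) and NONSURJ rows stay outside; nothing booked.

References: Kim 2026 [Kim2022StructureSelmer] Thm. 1.9 (6), §1.5.1, Conj. 1.10, Def. 2.13, Thm. 2.14;
Kim 2025 [Kim2025RefinedTNC] Thm. 1.1 (PREPRINT); Sakamoto 2024 [Sakamoto2024KolyvaginThree];
Büyükboduk, JNT 129 (2009) Cor. 3.3 (Tamagawa defect, `p > 3`; not used, named); Cassels 1962 /
Silverman AEC X.4.14 [SilvermanAEC2009]; Miller 2011 [Miller2011LMS] Def. 1.1; cells/n1011/PLAN.md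
R3-15 (GO), OWNERS T-a2r1b, T-N10C.
-/

noncomputable section

open scoped Classical MatrixGroups ModularForm

open CongruenceSubgroup WeierstrassCurve Literature.NumberTheory.EllipticCurves
  Literature.NumberTheory.EllipticCurves.ModularForms
  Literature.NumberTheory.EllipticCurves.Rank1Residual
  Literature.NumberTheory.EllipticCurves.Rank1Residual.Typed

namespace Summit.BirchSwinnertonDyer.Rank1Residual.Additive

/-! ## §0 `∂`-bookkeeping: ONE non-zero Kurihara number bounds `∂^{(1)}` -/

section Bookkeeping

variable (W : WeierstrassCurve ℚ) [W.IsGloballyMinimal] (p : ℕ) {N : ℕ} (f : CuspForm (Gamma0 N) 2)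

/-- **A Kurihara number NON-ZERO modulo `p^k` at a level `n ∈ 𝒩_k` has divisibility index `≤ k − 1`**
(it is not in `p^k ℤ_p/I_nℤ_p`; Kim §1.5.1 / Def. 2.13): the general-`k` form of
`kuriharaDivIndex_eq_zero_of_ne_zero`. [cite: Kim2022StructureSelmer, §1.5.1 (PDF p. 7), Def. 2.13 (PDF p. 14)] -/
theorem kuriharaDivIndex_le_of_kuriharaNumber_ne_zero {n k : ℕ} [NeZero n]
    (hn : Kato.IsKolyvaginProduct W p k n)
    (ψ : (ℓ : ℕ) → (ZMod ℓ)ˣ →* Multiplicative (ZMod (p ^ k)))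
    (hψ : ∀ ℓ ∈ n.primeFactors, Function.Surjective (ψ ℓ))
    (hne : kuriharaNumber f (p ^ k) n ψ ≠ 0) :
    kuriharaDivIndex W p f n ≤ ((k - 1 : ℕ) : ℕ∞) := by
  rw [kuriharaDivIndex_def]
  refine iSup₂_le fun j hj => ?_
  by_cases hjk : k ≤ j
  · exact absurd (hj k hjk hn ψ hψ) hne
  · exact_mod_cast (by omega : j ≤ k - 1)

/-- A Kolyvagin PRIME of level `k ≥ 1` with cyclic `p`-torsion in its reduction is a cyclic Kolyvagin
level (`ν = 1`). Bookkeeping. [cite: Kim2022StructureSelmer, §1.2.2 (PDF p. 5)] -/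
theorem isCyclicKolyvaginLevel_of_prime {k : ℕ} (hk : 1 ≤ k) {ℓ : ℕ} [Fact ℓ.Prime]
    (hℓ : Kato.IsKolyvaginPrime W p k ℓ)
    (hcyc : Nat.card {P : ((WeierstrassCurve.integralModelInt W).map
        (Int.castRingHom (ZMod ℓ))).toAffine.Point // p • P = 0} ≤ p) :
    IsCyclicKolyvaginLevel W p ℓ := by
  refine ⟨(hℓ.mono hk).isKolyvaginProduct, fun ℓ' _ hd => ?_⟩
  have hℓp : ℓ.Prime := Fact.out
  have hℓ'p : ℓ'.Prime := Fact.out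
  obtain rfl : ℓ' = ℓ := ((Nat.prime_dvd_prime_iff_eq hℓ'p hℓp).mp hd)
  exact hcyc

/-- **`∂^{(1)}(δ̃) ≤ k − 1` from ONE prime-level certificate**: a Kolyvagin prime `ℓ ∈ 𝒫_k(E,p)`,
`k ≥ 1`, with cyclic reduction `#Ẽ(𝔽_ℓ)[p] ≤ p`, a surjective `ψ_ℓ : (ℤ/ℓ)ˣ ↠ ℤ/p^k` and
`kuriharaNumber f (p^k) ℓ ψ ≠ 0` give `kuriharaPartial W p f 1 ≤ k − 1` (in particular `≠ ⊤`).
[cite: Kim2022StructureSelmer, §1.5.1 (PDF p. 7), Def. 2.13 (PDF p. 14)] -/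
theorem kuriharaPartial_one_le_of_kuriharaNumber_ne_zero {k : ℕ} (hk : 1 ≤ k) {ℓ : ℕ} [Fact ℓ.Prime]
    (hℓ : Kato.IsKolyvaginPrime W p k ℓ)
    (hcyc : Nat.card {P : ((WeierstrassCurve.integralModelInt W).map
        (Int.castRingHom (ZMod ℓ))).toAffine.Point // p • P = 0} ≤ p)
    (ψ : (ℓ' : ℕ) → (ZMod ℓ')ˣ →* Multiplicative (ZMod (p ^ k)))
    (hψ : Function.Surjective (ψ ℓ)) (hne : kuriharaNumber f (p ^ k) ℓ ψ ≠ 0) :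
    kuriharaPartial W p f 1 ≤ ((k - 1 : ℕ) : ℕ∞) := by
  have hℓp : ℓ.Prime := Fact.out
  have hcl := isCyclicKolyvaginLevel_of_prime W p hk hℓ hcyc
  have hcard : ℓ.primeFactors.card = 1 := by rw [hℓp.primeFactors, Finset.card_singleton]
  refine (kuriharaPartial_le W p f hcl hcard).trans ?_
  refine kuriharaDivIndex_le_of_kuriharaNumber_ne_zero W p f hℓ.isKolyvaginProduct ψ ?_ hne
  intro ℓ' hℓ'
  rw [hℓp.primeFactors, Finset.mem_singleton] at hℓ'
  subst hℓ'
  exact hψ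

end Bookkeeping

/-! ## §1 The rank-one structure clause in `∂`-currency, at a prime `p` (conjectures; nothing asserted) -/

/-- **Kim's clause (6) at the pair `(E, p)`, analytic rank `1`, WITH its `∂^{(∞)}` term** (T-a2's
binder convention: `5 ≤ p` removed, tower added): `ρ̄_{E,p}` onto, tower onto, `L(E,1) = 0`,
`r_an = 1`, `Ш(E/ℚ)` finite, datum `D` with `p ∤ c_D`, period transfer `Ω(W) = u·Ω⁺_{D.f}`,
`|u|_p = 1`, and `∂^{(1)}(δ̃) ≠ ∞` (some cyclic prime-level Kurihara number is non-zero, so that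
`ord(δ̃) = 1`) ⟹ **`length_{ℤ_p} Ш(E/ℚ)[p^∞] + ∂^{(∞)}(δ̃) = ∂^{(1)}(δ̃)`** (in `ℕ∞`; Kim's
`length = ∂^{(ord)} − ∂^{(∞)}` without subtraction). PRINTED for `p ≥ 5` (Thm. 1.9 (6); not yet a
tree fact in this currency — cc-typer-1 T1); ANNOUNCED for `p ≥ 3` under large image (Kim 2025
Thm. 1.1 (Str), PREPRINT, flag `Kim2025-preprint`); at `p = 3` OUR CONJECTURE. It refines
`KimRankOneUnitAt` / `KimRankOneLevelTwoAt` (§2). A predicate on `(W, p)`; nothing asserted.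
[cite: Kim2022StructureSelmer, Thm. 1.9 (1), (4), (6) (PDF pp. 7–8), §1.5.1, §1.2.5]
[cite: Kim2025RefinedTNC, Thm. 1.1 (Str) (PDF p. 4; ANNOUNCED preprint — the reason, not a source of truth)]
[cite: Sakamoto2024KolyvaginThree, Thm. 1.1] -/
@[conjecture] def KimRankOnePartialAt (W : WeierstrassCurve ℚ) [W.IsElliptic] [W.IsGloballyMinimal]
    (p : ℕ) [Fact p.Prime] : Prop :=
  W.HasSurjectiveModNGaloisRep p → (∀ n : ℕ, W.HasSurjectiveModNGaloisRep (p ^ n : ℕ)) →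
    W.entireLFunction 1 = 0 → W.analyticRank = 1 → Finite W.sha →
    ∀ {N : ℕ} [NeZero N] (D : ModularParametrizationData W N),
    ¬ (p : ℤ) ∣ D.maninConstant →
    (∃ u : ℚ, ‖(u : ℚ_[p])‖ = 1 ∧ W.realPeriodRat = u * plusPeriod D.f) →
    kuriharaPartial W p D.f 1 ≠ ⊤ →
    (padicValNat p (Nat.card (AddCommGroup.primaryComponent W.sha p)) : ℕ∞) +
        kuriharaPartialInfty W p D.f = kuriharaPartial W p D.f 1

/-- **Conjecture `KimThreeRankOnePartial`** — the `∂`-currency rank-one clause at `p = 3` for EVERY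
`E/ℚ` (no reduction binder, as printed): `∀ W, KimRankOnePartialAt W 3`. OPEN; PRINTED REASON (PRE):
Kim 2025 Thm. 1.1 (Str) / Sakamoto 2024. Team n1011 row T-a2r1b; nothing asserted.
[cite: Kim2025RefinedTNC, Thm. 1.1 (Str) (PDF p. 4; ANNOUNCED preprint — the reason, not a source of truth)]
[cite: Sakamoto2024KolyvaginThree, Thm. 1.1] [cite: Kim2022StructureSelmer, Thm. 1.9 (6), §1.2.5 (PDF p. 5)] -/
@[conjecture] def KimThreeRankOnePartial : Prop :=
  ∀ (W : WeierstrassCurve ℚ) [W.IsElliptic] [W.IsGloballyMinimal], KimRankOnePartialAt W 3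

/-- **Conjecture X4♯(3)-Kim, rank one, `∂`-currency = the O7 ∩ X4@3 hypothesis for the TAMAGAWA
rows**: `KimThreeRankOnePartial` restricted to an additive `3`. With the `≥` half of Kim's Conjecture
1.10 (`X4.KimTamagawaDefectGeAt W 3 D.f`, row T-N10C) it makes every X4 ∧ `r_an = 1` row at `3` with
a tower certificate and `3 ∤ #Ш_an` ONE-Kurihara-number-shaped (§3–§4), whatever `ord₃ ∏c_ℓ` is.
OPEN; nothing asserted; the EXOTIC (no tower) and non-surjective rows stay outside.
[cite: Kim2025RefinedTNC, Thm. 1.1 (Str) (PDF p. 4; ANNOUNCED preprint — the reason, not a source of truth)]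
[cite: Sakamoto2024KolyvaginThree, Thm. 1.1] -/
@[conjecture] def X4SharpThreeKimRankOnePartial : Prop :=
  ∀ (W : WeierstrassCurve ℚ) [W.IsElliptic] [W.IsGloballyMinimal],
    Addv W 3 → KimRankOnePartialAt W 3

/-- On class X4 at `3` the restricted conjecture yields the per-pair predicate. Bookkeeping. [folklore] -/
theorem kimRankOnePartialAt_three_of_classX4 (W : WeierstrassCurve ℚ) [W.IsElliptic]
    [W.IsGloballyMinimal] (h : X4SharpThreeKimRankOnePartial) (hX : ClassX4 W 3) :
    KimRankOnePartialAt W 3 :=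
  h W hX.2.1

/-! ## §2 Anti-drift inside T-a2r1's family: the `∂`-currency clause refines the landed shapes -/

section Refine

variable (W : WeierstrassCurve ℚ) [W.IsElliptic] [W.IsGloballyMinimal] (p : ℕ) [Fact p.Prime]

omit [W.IsElliptic] [W.IsGloballyMinimal] in
/-- A finite `p`-primary component of `p`-adic valuation `0` is trivial. [folklore] -/
theorem card_primaryComponent_eq_one_of_padicValNat_eq_zero [Finite W.sha]
    (h0 : padicValNat p (Nat.card (AddCommGroup.primaryComponent W.sha p)) = 0) :
    Nat.card (AddCommGroup.primaryComponent W.sha p) = 1 := by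
  obtain ⟨k, hk⟩ := exists_card_addPrimaryComponent_eq_pow (A := W.sha) p
  rw [hk] at h0 ⊢
  rw [padicValNat.prime_pow] at h0
  rw [h0, pow_zero]

/-- **`KimRankOnePartialAt ⟹ KimRankOneUnitAt`**: a UNIT Kurihara number at a cyclic prime level
gives `∂^{(1)}(δ̃) = 0` (`kuriharaPartial_eq_zero_of_ne_zero`), hence `length + ∂^{(∞)} = 0`, hence
`length = 0`, i.e. `#Ш(E/ℚ)(p) = 1`. [cite: Kim2022StructureSelmer, Thm. 1.9 (6) and §1.5.1 (PDF pp. 7–8)] -/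
theorem kimRankOneUnitAt_of_partial (hK : KimRankOnePartialAt W p) : KimRankOneUnitAt W p := by
  intro hsurj htower hL hr hfin N _ D hc hper ℓ _ hℓ hcyc ψ hψ hδ
  haveI : Finite W.sha := hfin
  have hcl : IsCyclicKolyvaginLevel W p ℓ := isCyclicKolyvaginLevel_of_prime W p le_rfl hℓ hcyc
  have hℓp : ℓ.Prime := Fact.out
  have hcard : ℓ.primeFactors.card = 1 := by rw [hℓp.primeFactors, Finset.card_singleton]
  have hψ' : ∀ ℓ' ∈ ℓ.primeFactors, Function.Surjective (ψ ℓ') := by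
    intro ℓ' hℓ'
    rw [hℓp.primeFactors, Finset.mem_singleton] at hℓ'
    subst hℓ'
    exact hψ
  have h1 : kuriharaPartial W p D.f 1 = 0 :=
    kuriharaPartial_eq_zero_of_ne_zero W p D.f hcl hcard ψ hψ' hδ
  have hmain := hK hsurj htower hL hr hfin D hc hper (by rw [h1]; exact ENat.zero_ne_top)
  rw [h1, add_eq_zero] at hmain
  have h0 : padicValNat p (Nat.card (AddCommGroup.primaryComponent W.sha p)) = 0 := by
    exact_mod_cast hmain.1
  exact card_primaryComponent_eq_one_of_padicValNat_eq_zero W p h0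

/-- **`KimRankOnePartialAt ⟹ KimRankOneLevelTwoAt`**: a Kurihara number non-zero modulo `p²` at a
cyclic `ℓ ∈ 𝒫₂` gives `∂^{(1)}(δ̃) ≤ 1`, hence `length + ∂^{(∞)} ≤ 1`, hence `length ≤ 1`.
[cite: Kim2022StructureSelmer, Thm. 1.9 (6), §1.2.2, §1.5.1 (PDF pp. 5–8)] -/
theorem kimRankOneLevelTwoAt_of_partial (hK : KimRankOnePartialAt W p) :
    KimRankOneLevelTwoAt W p := by
  intro hsurj htower hL hr hfin N _ D hc hper ℓ _ hℓ hcyc ψ hψ hδ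
  have h1 : kuriharaPartial W p D.f 1 ≤ ((2 - 1 : ℕ) : ℕ∞) :=
    kuriharaPartial_one_le_of_kuriharaNumber_ne_zero W p D.f (by norm_num) hℓ hcyc ψ hψ hδ
  have hne : kuriharaPartial W p D.f 1 ≠ ⊤ := ne_top_of_le_ne_top (ENat.coe_ne_top _) h1
  have hmain := hK hsurj htower hL hr hfin D hc hper hne
  have h2 : (padicValNat p (Nat.card (AddCommGroup.primaryComponent W.sha p)) : ℕ∞) ≤
      ((2 - 1 : ℕ) : ℕ∞) :=
    le_trans (le_trans le_self_add (le_of_eq hmain)) h1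
  exact_mod_cast h2

end Refine

end Summit.BirchSwinnertonDyer.Rank1Residual.Additive

end
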